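import Summits.QuantumFields.YangMills.Theorems.UnitScaleTiltCoverLetters
import Summits.QuantumFields.YangMills.Theorems.UnitScaleTiltCoverPullback
import HarnessLib

/-!
# Route `UnitScaleTilt`, crux K1 «MinimiserStabilityRegPr» (stmt-QuantumFields-19200), leaf `stub_halvingStep` — the (P2-small) branch by COVERING
# (★★OWNER RULINGS g26-№18 (α) ∕ ACK 30, brick α5, part 2): **THE `∂*∂` ROW OF (161)₁ ON THE COVER — the stencil binder `hdd` of ✓`CoverLetters.lettersMS_of_cover` DISCHARGED**

Cell `ym3-torus` (HUMAN RULING D-0037, YM ladder rung R3 — continuum SU(2) YM₃ on the torus is a RUNG, not the Clay problem), explicit-unit helper seat `ym-ust-19200-w4` gen 3.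
Def-free; `--supports stmt-QuantumFields-19200 --as helper`; counts toward nothing by itself.

✓`CoverLetters.hDecayLetterD_of_cover` ∕ `lettersMS_of_cover` (α5) take, besides the key-lemma identities `hH`∕`hGt` (α4: `H̃ (X ∘ π) = (H X) ∘ π`), ONE stencil identity for the third row
of (161)₁, whose operator `∂*` is an ADJOINT (`dcsE = (dcE)†`, [Balaban1984PropagatorsII] (2.19)): `∂̃*∂̃(g ∘ π) = (∂*∂ g) ∘ π`.  ★w1-20520 g5's ✓(A) `CoverPullback.h1_pull` proves exactly this on
`ℓ²` (`(∂*∂)(π_B u) = π_B((∂*∂) u)`, adjoints intertwine with pullbacks because curl intertwines with fibre sums, ✓`CoverFlatOps.adjoint_intertwine_of_push`); here it is read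
componentwise at the T³ letters (`dcsE_dcE_cover`) and fed to α5: ★★★ `lettersMS_of_cover'` = `lettersMS_of_cover` WITHOUT the `hdd` binder — so α6 needs only `flatH_cover`∕`flatGt_cover`.
HONEST SCOPE: bookkeeping; nothing of print is asserted; NOT a claim about the stub, the crux or the gap.

References: T. Bałaban, CMP **96** (1984) 223–250 [Balaban1984PropagatorsII] ((2.5) p.224, (2.8) p.224, (2.19) p.226, Cor. 2.8 (2.150)–(2.151) p.249); CMP **102** (1985) 277–309
[Balaban1985Variational] ((161) p.303).
-/

open scoped BigOperators

noncomputable section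

namespace Summit.QuantumFields.YangMills.Theorems.CoverLetters

open Literature.MathematicalPhysics.QuantumFieldTheory.Balaban1983to89
open Literature.MathematicalPhysics.QuantumFieldTheory.BalabanImbrieJaffe1984to88.BIJ85AxialPropagator411 (BondSpace)
open B6SectADomainsV1 (Domains)
open B6SectAOperatorsV1 (BondIdx onE dcE dcsE)
open T3ContinuumYM3Torus (T3Family)
open FlatCubeOpsText (distBI IsLevWeight HSupLetterG GtSupLetterG GtLaplaceLetterG HDecayLetterD RowSum162)
open CoverSites (cover projBond)
open CoverDomains (projIdx)

variable (F : T3Family) (n K jc : ℕ)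

/-- ★ **`∂̃*∂̃(g ∘ π) = (∂*∂ g) ∘ π`, COMPONENTWISE AT THE T³ LETTERS** (any `g̃` agreeing with `g ∘ π` pointwise; lattice constant `L^{K−n}` on both sides): ✓`CoverPullback.h1_pull` read at
the bond `b̃` through `onE_funLeft_apply`. [cite: Balaban1984PropagatorsII, (2.19) p.226, (2.8) p.224] -/
theorem dcsE_dcE_cover (g : PBond (F.P K) 0 → ℝ) (gt : PBond ((F.cover jc).P K) 0 → ℝ) (hgt : ∀ bt', gt bt' = g (projBond (F.P K) jc 0 bt'))
    (bt : PBond ((F.cover jc).P K) 0) :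
    (dcsE ((F.L : ℝ) ^ (K - n)) (dcE ((F.L : ℝ) ^ (K - n)) (WithLp.toLp 2 gt))) bt =
      (dcsE ((F.L : ℝ) ^ (K - n)) (dcE ((F.L : ℝ) ^ (K - n)) (WithLp.toLp 2 g))) (projBond (F.P K) jc 0 bt) := by
  -- the periodic datum IS the pullback of `g`
  have e1 : (WithLp.toLp 2 gt : BondSpace (cover (F.P K) jc)) = onE (LinearMap.funLeft ℝ ℝ (projBond (F.P K) jc 0)) (WithLp.toLp 2 g) :=
    PiLp.ext fun bt' => hgt bt'
  have h := CoverPullback.h1_pull (F.P K) jc ((F.L : ℝ) ^ (K - n)) (WithLp.toLp 2 g)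
  rw [LinearMap.comp_apply, LinearMap.comp_apply, ← e1] at h
  have h' := congrArg (fun v : BondSpace (cover (F.P K) jc) => v bt) h
  simp only [CoverPullback.onE_funLeft_apply] at h'
  exact h'

variable (D : Domains (F.P K)) [DecidableEq (BondIdx D)]
variable {w : ℕ → PBond (F.P K) 0 → ℝ} {B₀ δ₀ B₃ : ℝ}
variable {H : (BondIdx D → ℝ) →ₗ[ℝ] (PBond (F.P K) 0 → ℝ)} {Ht : (BondIdx (P := (F.cover jc).P K) (D.comap jc) → ℝ) →ₗ[ℝ] (PBond ((F.cover jc).P K) 0 → ℝ)}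
variable {Gt : (PBond (F.P K) 0 → ℝ) →ₗ[ℝ] (PBond (F.P K) 0 → ℝ)} {Gtt : (PBond ((F.cover jc).P K) 0 → ℝ) →ₗ[ℝ] (PBond ((F.cover jc).P K) 0 → ℝ)}
variable {dBIt : PBond ((F.cover jc).P K) 0 → BondIdx (P := (F.cover jc).P K) (D.comap jc) → ℝ}

/-- ★★ **(161)₁ DESCENDS** — ✓`hDecayLetterD_of_cover` with the stencil binder discharged. [cite: Balaban1985Variational, (161) p.303; Balaban1984PropagatorsII, Cor. 2.8 p.249] -/
theorem hDecayLetterD_of_cover' (hB₀ : 0 ≤ B₀) (hδ₀ : 0 ≤ δ₀)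
    (hH : ∀ (X : BondIdx D → ℝ) (bt : PBond ((F.cover jc).P K) 0), Ht (fun ct => X (projIdx D jc ct)) bt = H X (projBond (F.P K) jc 0 bt))
    (hup : HDecayLetterD (F.cover jc) n K (D.comap jc) dBIt (fun m bt => w m (projBond (F.P K) jc 0 bt)) Ht B₀ δ₀) :
    HDecayLetterD F n K D (dBImin D jc dBIt) w H (B₀ * ((F.L ^ jc) ^ 3 : ℕ)) δ₀ :=
  hDecayLetterD_of_cover F n K jc D hB₀ hδ₀ hH (dcsE_dcE_cover F n K jc) hup

/-- ★★★ **THE LETTERS OF THE SMALL MEMBER FROM THOSE OF ITS COVER, KEY LEMMA ONLY**: ✓`lettersMS_of_cover` with the stencil binder `hdd` discharged by `dcsE_dcE_cover` — α6 supplies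
`hH := flatH_cover`, `hGt := flatGt_cover` (α4) and the upstairs body, and reads the `FlatOpsAdmAtMS`-shaped conjunction downstairs with constants `(B₀·(L^{jc})^3, δ₀, B₃)`.
[cite: Balaban1985Variational, (46) p.285, (161)–(162) p.303, (165) p.304; Balaban1984PropagatorsII, Cor. 2.8 p.249] -/
theorem lettersMS_of_cover' (hw : IsLevWeight F n K D w) (hB₀ : 0 ≤ B₀) (hδ₀ : 0 ≤ δ₀)
    (hH : ∀ (X : BondIdx D → ℝ) (bt : PBond ((F.cover jc).P K) 0), Ht (fun ct => X (projIdx D jc ct)) bt = H X (projBond (F.P K) jc 0 bt))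
    (hGt : ∀ (f : PBond (F.P K) 0 → ℝ) (bt : PBond ((F.cover jc).P K) 0), Gtt (fun bt' => f (projBond (F.P K) jc 0 bt')) bt = Gt f (projBond (F.P K) jc 0 bt))
    (h1 : HSupLetterG (F.cover jc) n K (D.comap jc) (fun m bt => w m (projBond (F.P K) jc 0 bt)) Ht B₀)
    (h2 : GtSupLetterG (F.cover jc) n K (fun m bt => w m (projBond (F.P K) jc 0 bt)) Gtt B₀)
    (h3 : GtLaplaceLetterG (F.cover jc) n K (fun m bt => w m (projBond (F.P K) jc 0 bt)) Gtt B₀)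
    (hdom : ∀ bt ct, distBI (D.comap jc) bt ct ≤ dBIt bt ct)
    (h4 : RowSum162 (F.cover jc) n K (D.comap jc) dBIt (fun m bt => w m (projBond (F.P K) jc 0 bt)) δ₀ B₃)
    (h5 : HDecayLetterD (F.cover jc) n K (D.comap jc) dBIt (fun m bt => w m (projBond (F.P K) jc 0 bt)) Ht B₀ δ₀) :
    HSupLetterG F n K D w H (B₀ * ((F.L ^ jc) ^ 3 : ℕ)) ∧ GtSupLetterG F n K w Gt (B₀ * ((F.L ^ jc) ^ 3 : ℕ)) ∧ GtLaplaceLetterG F n K w Gt (B₀ * ((F.L ^ jc) ^ 3 : ℕ)) ∧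
      ∃ dBI : PBond (F.P K) 0 → BondIdx D → ℝ,
        (∀ b c, distBI D b c ≤ dBI b c) ∧ RowSum162 F n K D dBI w δ₀ B₃ ∧ HDecayLetterD F n K D dBI w H (B₀ * ((F.L ^ jc) ^ 3 : ℕ)) δ₀ :=
  lettersMS_of_cover F n K jc D hw hB₀ hδ₀ hH hGt (dcsE_dcE_cover F n K jc) h1 h2 h3 hdom h4 h5

end Summit.QuantumFields.YangMills.Theorems.CoverLetters

end
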